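import Summits.AtomisticToContinuum.Crystallization.Theorems.FrustratedLawDichotomyVacancyFloor
import Summits.AtomisticToContinuum.Crystallization.Theorems.FrustratedLawDichotomyNoFiniteSelection
import Summits.AtomisticToContinuum.Crystallization.Theorems.FrustratedLawDichotomyMinimisersInfinite

/-!
# FrustratedLawDichotomy · crux `AperiodicFrustratedLawGap` (stmt-AtomisticToContinuum-27623) — THE SHARP VACANCY FLOOR `Φ ≥ 2e⋆`
# (decomp-a2c, prover hand 1, direct share, generation 5)

`FrustratedLawDichotomyVacancyFloor` proved, from clauses (a)(b)(e) and the energy floor of item 9229, that almost surely the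
Lennard-Jones field `Φ_μ(y) = Σ_q V_LJ(dist y q)` at every vacant point is `≥ 2e⋆ − 1/12`; the `1/12` is the pair term `−V_LJ(dist y 0)`
paid when the root itself jumps into the hole.  Here the `1/12` is removed for laws almost surely carried by INFINITE configurations —
in particular for every MINIMISING law (`ae_infinite_of_minimising`, hand 2), hence for every counterexample to the crux:

* §1 the covariant selection «atoms within `R` of a `c`-deep hole» (`Sel c R`, countable dense-sequence form): jointly measurable
  (`measurableSet_sel`) and covariant under re-rooting of hard-core configurations (`sel_covariant`, via the located witnesses
  `exists_denseSeq_hole_near`);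
* §2 **`measure_holeEvent_eq_zero_of_nash_of_infinite`** — for `c < 2e⋆`, the deep-hole event `{∃ n, d_n vacant ∧ Φ(d_n) < c}` is
  `P`-null under (a)(b)(e), the floor, and «a.s. infinitely many atoms».  On the conditioned law, NO FINITE COVARIANT SELECTION
  (`ae_not_finite_nonempty_selection`) forces the `c`-deep holes of almost every configuration to be UNBOUNDED (else the atoms within
  `R` of them form a finite non-empty covariant set containing the root), so the root sees `c`-deep holes arbitrarily far away and the
  two-point inequality with its pair term (`two_mul_rootEnergy_le_field_add_tail_of_nash`) gives `2·rootEnergy ≤ c + (1/6)L⁻⁶` for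
  every `L`, i.e. `rootEnergy ≤ c/2 < e⋆` almost surely — against the floor for the conditioned law;
* **`ae_vacancyFloor_sharp_of_nash`** / **`ae_vacancyFloor_sharp_of_minimising`** (+ `…_tsum_…`): almost surely
  `∀ y, μ {y} = 0 → 2e⋆ ≤ Φ_μ(y)` — under (a)(b)(e) + a.s. infinite, resp. under (a)(b)(e) + `E_P[rootEnergy] ≤ e⋆`.

Reading: in an exact Lennard-Jones minimiser that is Nash, NO vacant site is more attractive than the mean one-particle energy `2e⋆`
(«no site better than average»); the census form: every finite textured cluster with a vacant point of truncated field `< 2e⋆ − tail`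
is excluded.  The by-name cut is `FrustratedLawDichotomyVacancySharpCut`.  All `[folklore]`.
-/

noncomputable section

namespace Summit.AtomisticToContinuum.Crystallization.Theorems.FrustratedLawDichotomyVacancyFloorSharp

open MeasureTheory Metric Set Filter Topology TopologicalSpace ProbabilityTheory
open scoped ENNReal BigOperators
open Literature.MathematicalPhysics.StatisticalMechanics Literature.Probability.Process
open Literature.Probability.Process.LocalConfig (finite_inter_of_separated)
open Summit.AtomisticToContinuum.Crystallization.Theorems.ChargedEnergyGapNegative (E3 eStar)
open Summit.AtomisticToContinuum.Crystallization.Theorems.FrustratedLawDichotomyFiniteClusterGap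
  (integrable_rootEnergy_of_ae_hardCore setOf_count_restrict_singleton_ne_zero count_restrict_univ_of_infinite)
open Summit.AtomisticToContinuum.Crystallization.Theorems.FrustratedLawDichotomyAperiodicGapFiniteCut
  (isPointStationaryLaw_restrict_of_hc_invariant isProbabilityMeasure_cond' ae_infinite_of_minimising)
open Summit.AtomisticToContinuum.Crystallization.Theorems.FrustratedLawDichotomyVacancyField
open Summit.AtomisticToContinuum.Crystallization.Theorems.FrustratedLawDichotomyVacancyFloor
open Summit.AtomisticToContinuum.Crystallization.Theorems.FrustratedLawDichotomyNoFiniteSelection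

/-! ## §1. The selection «within `R` of a `c`-deep hole» -/

section Sel

variable {δ : ℝ}

/-- The selection is jointly measurable. [folklore] -/
theorem measurableSet_sel (c R : ℝ) :
    MeasurableSet {x : Measure E3 × E3 | ∃ n : ℕ, x.1 {denseSeq E3 n} = 0 ∧
      (∫⁻ z, ENNReal.ofReal (lennardJones (dist (denseSeq E3 n) z)) ∂x.1).toReal -
        (∫⁻ z, ENNReal.ofReal (-lennardJones (dist (denseSeq E3 n) z)) ∂x.1).toReal < c ∧
      dist x.2 (denseSeq E3 n) < R} := by
  have h : {x : Measure E3 × E3 | ∃ n : ℕ, x.1 {denseSeq E3 n} = 0 ∧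
      (∫⁻ z, ENNReal.ofReal (lennardJones (dist (denseSeq E3 n) z)) ∂x.1).toReal -
        (∫⁻ z, ENNReal.ofReal (-lennardJones (dist (denseSeq E3 n) z)) ∂x.1).toReal < c ∧
      dist x.2 (denseSeq E3 n) < R} =
      ⋃ n : ℕ, ({ν : Measure E3 | ν {denseSeq E3 n} = 0} ∩ {ν : Measure E3 |
        (∫⁻ z, ENNReal.ofReal (lennardJones (dist (denseSeq E3 n) z)) ∂ν).toReal -
          (∫⁻ z, ENNReal.ofReal (-lennardJones (dist (denseSeq E3 n) z)) ∂ν).toReal < c}) ×ˢ ball (denseSeq E3 n) R := by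
    ext x
    simp only [mem_setOf_eq, mem_iUnion, mem_prod, mem_inter_iff, mem_ball, and_assoc]
  rw [h]
  refine MeasurableSet.iUnion fun n => MeasurableSet.prod (MeasurableSet.inter ?_ ?_) measurableSet_ball
  · exact (Measure.measurable_coe (measurableSet_singleton _)) (measurableSet_singleton 0)
  · obtain ⟨hp, hn⟩ := measurable_lintegral_field (denseSeq E3 n)
    exact measurableSet_lt (hp.ennreal_toReal.sub hn.ennreal_toReal) measurable_const

/-- A point within `R` of ANY `c`-deep hole of a rooted hard-core configuration is selected (located dense witnesses). [folklore] -/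
theorem mem_sel_of_hole (hδ : 0 < δ) {ν : Measure E3} (hν : IsRootedHardCore δ ν) {y : E3} (hy : ν {y} = 0) {c : ℝ}
    (hc : (∫⁻ z, ENNReal.ofReal (lennardJones (dist y z)) ∂ν).toReal -
      (∫⁻ z, ENNReal.ofReal (-lennardJones (dist y z)) ∂ν).toReal < c) {z : E3} {R : ℝ} (hz : dist z y < R) :
    (ν, z) ∈ {x : Measure E3 × E3 | ∃ n : ℕ, x.1 {denseSeq E3 n} = 0 ∧
      (∫⁻ z, ENNReal.ofReal (lennardJones (dist (denseSeq E3 n) z)) ∂x.1).toReal -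
        (∫⁻ z, ENNReal.ofReal (-lennardJones (dist (denseSeq E3 n) z)) ∂x.1).toReal < c ∧
      dist x.2 (denseSeq E3 n) < R} := by
  obtain ⟨S, -, hsep, rfl⟩ := hν
  have hmem := count_restrict_singleton_ne_zero_iff (E := E3) S
  have hyS : y ∉ S := fun h => (hmem y).2 h hy
  obtain ⟨n, hnS, hnear, hlt⟩ := exists_denseSeq_hole_near hδ hsep hyS hc (by linarith : 0 < R - dist z y)
  refine ⟨n, ?_, hlt, ?_⟩
  · by_contra h
    exact hnS ((hmem _).1 h)
  · calc dist z (denseSeq E3 n) ≤ dist z y + dist y (denseSeq E3 n) := dist_triangle _ _ _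
      _ < R := by rw [dist_comm y]; linarith

/-- **The selection is covariant** under re-rooting of rooted hard-core configurations. [folklore] -/
theorem sel_covariant (hδ : 0 < δ) (c R : ℝ) (μ : Measure E3) (hμ : IsRootedHardCore δ μ) (p : E3) (hp : μ {p} ≠ 0) (z : E3) :
    (Measure.map (fun w : E3 => w - p) μ, z - p) ∈ {x : Measure E3 × E3 | ∃ n : ℕ, x.1 {denseSeq E3 n} = 0 ∧
      (∫⁻ z, ENNReal.ofReal (lennardJones (dist (denseSeq E3 n) z)) ∂x.1).toReal -
        (∫⁻ z, ENNReal.ofReal (-lennardJones (dist (denseSeq E3 n) z)) ∂x.1).toReal < c ∧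
      dist x.2 (denseSeq E3 n) < R} ↔
    (μ, z) ∈ {x : Measure E3 × E3 | ∃ n : ℕ, x.1 {denseSeq E3 n} = 0 ∧
      (∫⁻ z, ENNReal.ofReal (lennardJones (dist (denseSeq E3 n) z)) ∂x.1).toReal -
        (∫⁻ z, ENNReal.ofReal (-lennardJones (dist (denseSeq E3 n) z)) ∂x.1).toReal < c ∧
      dist x.2 (denseSeq E3 n) < R} := by
  have hμ' : IsRootedHardCore δ (Measure.map (fun w : E3 => w - p) μ) := hμ.map_sub hp
  constructor
  · rintro ⟨n, hvac', hlt', hdist'⟩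
    -- `d_n + p` is a `c`-deep hole of `μ` within `R` of `z`
    have hvac : μ {denseSeq E3 n + p} = 0 := by rw [← map_sub_apply_singleton, hvac']
    obtain ⟨h1, h2⟩ := lintegral_field_map_sub μ p (denseSeq E3 n)
    refine mem_sel_of_hole hδ hμ hvac (y := denseSeq E3 n + p) ?_ ?_
    · rw [← h1, ← h2]; exact hlt'
    · have : dist z (denseSeq E3 n + p) = dist (z - p) (denseSeq E3 n) := by
        rw [dist_eq_norm, dist_eq_norm]; congr 1; abel
      rw [this]; exact hdist'
  · rintro ⟨n, hvac, hlt, hdist⟩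
    -- `d_n - p` is a `c`-deep hole of `θ_p μ` within `R` of `z - p`
    have hvac' : Measure.map (fun w : E3 => w - p) μ {denseSeq E3 n - p} = 0 := by
      rw [map_sub_apply_singleton, sub_add_cancel, hvac]
    obtain ⟨h1, h2⟩ := lintegral_field_map_sub μ p (denseSeq E3 n - p)
    refine mem_sel_of_hole hδ hμ' hvac' (y := denseSeq E3 n - p) ?_ ?_
    · rw [h1, h2, sub_add_cancel]; exact hlt
    · have : dist (z - p) (denseSeq E3 n - p) = dist z (denseSeq E3 n) := by
        rw [dist_eq_norm, dist_eq_norm]; congr 1; abel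
      rw [this]; exact hdist

end Sel

/-! ## §2. The sharp vacancy floor -/

section Law

variable {δ : ℝ} {P : Measure (Measure E3)}

/-- **The deep-hole event below `2e⋆` is null for laws with infinitely many atoms.**  Granted the floor of item 9229, under clauses
(a), (b), (e) of the crux and «a.s. `μ univ = ∞`», `P {∃ n, d_n vacant ∧ Φ(d_n) < c} = 0` for every `c < 2e⋆`. [folklore] -/
theorem measure_holeEvent_eq_zero_of_nash_of_infinite
    (hU : ∀ δ' : ℝ, 0 < δ' → ∀ Q : Measure (Measure E3), IsProbabilityMeasure Q → (∀ᵐ μ ∂Q, IsRootedHardCore δ' μ) →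
      IsPointStationaryLaw Q → eStar ≤ ∫ μ, rootEnergy lennardJones μ ∂Q)
    (hδ : 0 < δ) [IsProbabilityMeasure P] (ha : ∀ᵐ μ ∂P, IsRootedHardCore δ μ) (hb : IsPointStationaryLaw P)
    (he : ∀ᵐ μ ∂P, ∀ p : E3, μ {p} ≠ 0 → ∀ y : E3, (∀ q : E3, μ {q} ≠ 0 → q ≠ p → y ≠ q) →
      ∑' q : {q : E3 // μ {q} ≠ 0 ∧ q ≠ p}, lennardJones (dist p (q : E3)) ≤
        ∑' q : {q : E3 // μ {q} ≠ 0 ∧ q ≠ p}, lennardJones (dist y (q : E3)))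
    (hinf : ∀ᵐ μ ∂P, μ univ = ∞) {c : ℝ} (hc : c < 2 * eStar) :
    P {ν : Measure E3 | ∃ n : ℕ, ν {denseSeq E3 n} = 0 ∧
      (∫⁻ z, ENNReal.ofReal (lennardJones (dist (denseSeq E3 n) z)) ∂ν).toReal -
        (∫⁻ z, ENNReal.ofReal (-lennardJones (dist (denseSeq E3 n) z)) ∂ν).toReal < c} = 0 := by
  set K : Set (Measure E3) := {ν : Measure E3 | ∃ n : ℕ, ν {denseSeq E3 n} = 0 ∧
      (∫⁻ z, ENNReal.ofReal (lennardJones (dist (denseSeq E3 n) z)) ∂ν).toReal -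
        (∫⁻ z, ENNReal.ofReal (-lennardJones (dist (denseSeq E3 n) z)) ∂ν).toReal < c} with hK
  have hKm : MeasurableSet K := measurableSet_holeEvent c
  by_contra h0
  haveI : IsProbabilityMeasure ((P K)⁻¹ • P.restrict K) := isProbabilityMeasure_cond' h0
  have ha' : ∀ᵐ μ ∂((P K)⁻¹ • P.restrict K), IsRootedHardCore δ μ := Measure.ae_smul_measure (ae_restrict_of_ae ha) _
  have hb' : IsPointStationaryLaw ((P K)⁻¹ • P.restrict K) :=
    (isPointStationaryLaw_restrict_of_hc_invariant hδ ha hb hKm (fun μ hμ p hp => holeEvent_invariant hδ c μ hμ p hp)).smul _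
  have hK' : ∀ᵐ μ ∂((P K)⁻¹ • P.restrict K), μ ∈ K := Measure.ae_smul_measure (ae_restrict_mem hKm) _
  have he' := Measure.ae_smul_measure (ae_restrict_of_ae he (s := K)) (P K)⁻¹
  have hinf' : ∀ᵐ μ ∂((P K)⁻¹ • P.restrict K), μ univ = ∞ := Measure.ae_smul_measure (ae_restrict_of_ae hinf) _
  -- no finite covariant selection, for every radius `R : ℕ`
  have hsel : ∀ᵐ μ ∂((P K)⁻¹ • P.restrict K), ∀ R : ℕ,
      ¬ (0 < μ {z | (μ, z) ∈ {x : Measure E3 × E3 | ∃ n : ℕ, x.1 {denseSeq E3 n} = 0 ∧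
        (∫⁻ z, ENNReal.ofReal (lennardJones (dist (denseSeq E3 n) z)) ∂x.1).toReal -
          (∫⁻ z, ENNReal.ofReal (-lennardJones (dist (denseSeq E3 n) z)) ∂x.1).toReal < c ∧
        dist x.2 (denseSeq E3 n) < (R : ℝ)}} ∧
        μ {z | (μ, z) ∈ {x : Measure E3 × E3 | ∃ n : ℕ, x.1 {denseSeq E3 n} = 0 ∧
        (∫⁻ z, ENNReal.ofReal (lennardJones (dist (denseSeq E3 n) z)) ∂x.1).toReal -
          (∫⁻ z, ENNReal.ofReal (-lennardJones (dist (denseSeq E3 n) z)) ∂x.1).toReal < c ∧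
        dist x.2 (denseSeq E3 n) < (R : ℝ)}} < ∞) := by
    rw [ae_all_iff]
    intro R
    exact ae_not_finite_nonempty_selection hδ ha' hinf' hb' (measurableSet_sel c R) (fun μ hμ p hp z => sel_covariant hδ c R μ hμ p hp z)
  -- the floor for the conditioned law
  have hfloor := hU δ hδ _ inferInstance ha' hb'
  -- every configuration of `K` has root energy `≤ c/2`
  have hbd : ∀ᵐ μ ∂((P K)⁻¹ • P.restrict K), rootEnergy lennardJones μ ≤ c / 2 := by
    filter_upwards [ha', hK', he', hinf', hsel] with μ hμ hμK hN hμinf hS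
    obtain ⟨n, hvac, hlt⟩ := hμK
    have h00 : μ {0} ≠ 0 := by rw [hμ.measure_zero_singleton]; exact one_ne_zero
    -- `c`-deep holes arbitrarily far from the root
    have hfar : ∀ L : ℝ, ∃ m : ℕ, μ {denseSeq E3 m} = 0 ∧
        (∫⁻ z, ENNReal.ofReal (lennardJones (dist (denseSeq E3 m) z)) ∂μ).toReal -
          (∫⁻ z, ENNReal.ofReal (-lennardJones (dist (denseSeq E3 m) z)) ∂μ).toReal < c ∧ L ≤ dist (denseSeq E3 m) 0 := by
      intro L
      by_contra hcon
      push Not at hcon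
      obtain ⟨R, hR⟩ := exists_nat_gt (dist (0 : E3) (denseSeq E3 n))
      refine hS R ⟨?_, ?_⟩
      · -- the root is selected
        refine lt_of_lt_of_le (pos_iff_ne_zero.2 h00) (measure_mono (singleton_subset_iff.2 ?_))
        exact ⟨n, hvac, hlt, hR⟩
      · -- the selected set lies in the ball `B(0, L + R)`, which carries finitely many atoms
        have hsub : {z : E3 | (μ, z) ∈ {x : Measure E3 × E3 | ∃ n : ℕ, x.1 {denseSeq E3 n} = 0 ∧
            (∫⁻ z, ENNReal.ofReal (lennardJones (dist (denseSeq E3 n) z)) ∂x.1).toReal -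
              (∫⁻ z, ENNReal.ofReal (-lennardJones (dist (denseSeq E3 n) z)) ∂x.1).toReal < c ∧
            dist x.2 (denseSeq E3 n) < (R : ℝ)}} ⊆ closedBall (0 : E3) (L + R) := by
          rintro z ⟨m, hvm, hlm, hdm⟩
          have hLm := hcon m hvm hlm
          rw [mem_closedBall]
          calc dist z 0 ≤ dist z (denseSeq E3 m) + dist (denseSeq E3 m) 0 := dist_triangle _ _ _
            _ ≤ L + R := by linarith
        refine lt_of_le_of_lt (measure_mono hsub) ?_
        obtain ⟨S, h0, hsep, rfl⟩ := hμ
        rw [Measure.restrict_apply measurableSet_closedBall, Measure.count_apply_lt_top]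
        exact finite_inter_of_separated hδ hsep (isCompact_closedBall _ _)
    -- the two-point inequality with far holes: `2·rootEnergy ≤ c + (1/6) L⁻⁶` for every `L ≥ 1`
    have h2 : ∀ L : ℝ, 1 ≤ L → 2 * rootEnergy lennardJones μ ≤ c + 1 / 6 * L⁻¹ := by
      intro L hL
      obtain ⟨m, hvm, hlm, hLm⟩ := hfar L
      have h := two_mul_rootEnergy_le_field_add_tail_of_nash hδ hμ (hN 0 h00) hvm
      have hd : L ≤ dist (denseSeq E3 m) (0 : E3) := hLm
      have hdpos : 0 < dist (denseSeq E3 m) (0 : E3) := by linarith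
      have hinv : (dist (denseSeq E3 m) (0 : E3))⁻¹ ≤ L⁻¹ := (inv_le_inv₀ hdpos (by linarith)).2 hd
      have hinv1 : L⁻¹ ≤ 1 := inv_le_one_of_one_le₀ hL
      have hinv0 : 0 ≤ (dist (denseSeq E3 m) (0 : E3))⁻¹ := inv_nonneg.2 hdpos.le
      have hpow : (dist (denseSeq E3 m) (0 : E3))⁻¹ ^ 6 ≤ L⁻¹ := by
        calc (dist (denseSeq E3 m) (0 : E3))⁻¹ ^ 6 ≤ L⁻¹ ^ 6 := pow_le_pow_left₀ hinv0 hinv 6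
          _ ≤ L⁻¹ := pow_le_of_le_one (by positivity) hinv1 (by norm_num)
      linarith
    -- hence `2·rootEnergy ≤ c`
    have h3 : 2 * rootEnergy lennardJones μ ≤ c := by
      by_contra hlt'
      rw [not_le] at hlt'
      obtain ⟨L, hL⟩ := exists_nat_gt (max 1 (1 / (6 * (2 * rootEnergy lennardJones μ - c))))
      have hL1 : (1 : ℝ) ≤ L := ((le_max_left _ _).trans hL.le)
      have hgap : 0 < 2 * rootEnergy lennardJones μ - c := by linarith
      have hLpos : (0 : ℝ) < L := by linarith
      have h := h2 L hL1
      have hL' : 1 / (6 * (2 * rootEnergy lennardJones μ - c)) < L := (le_max_right _ _).trans_lt hL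
      have : 1 / 6 * (L : ℝ)⁻¹ < 2 * rootEnergy lennardJones μ - c := by
        rw [div_lt_iff₀ (by positivity)] at hL'
        rw [show 1 / 6 * (L : ℝ)⁻¹ = 1 / (6 * L) by field_simp]
        rw [div_lt_iff₀ (by positivity)]
        linarith
      linarith
    linarith
  have hint : Integrable (fun μ : Measure E3 => rootEnergy lennardJones μ) ((P K)⁻¹ • P.restrict K) :=
    integrable_rootEnergy_of_ae_hardCore hδ ha'
  have hle := integral_mono_ae hint (integrable_const (c / 2)) hbd
  rw [integral_const, smul_eq_mul, probReal_univ, one_mul] at hle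
  linarith

/-- **THE SHARP VACANCY FLOOR** for laws with infinitely many atoms.  Granted the floor of item 9229, under clauses (a), (b), (e) of the
crux and «a.s. `μ univ = ∞`», `P`-almost surely `∀ y, μ {y} = 0 → 2e⋆ ≤ Φ_μ(y)` (parts form). [folklore] -/
theorem ae_vacancyFloor_sharp_of_nash
    (hU : ∀ δ' : ℝ, 0 < δ' → ∀ Q : Measure (Measure E3), IsProbabilityMeasure Q → (∀ᵐ μ ∂Q, IsRootedHardCore δ' μ) →
      IsPointStationaryLaw Q → eStar ≤ ∫ μ, rootEnergy lennardJones μ ∂Q)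
    (hδ : 0 < δ) [IsProbabilityMeasure P] (ha : ∀ᵐ μ ∂P, IsRootedHardCore δ μ) (hb : IsPointStationaryLaw P)
    (he : ∀ᵐ μ ∂P, ∀ p : E3, μ {p} ≠ 0 → ∀ y : E3, (∀ q : E3, μ {q} ≠ 0 → q ≠ p → y ≠ q) →
      ∑' q : {q : E3 // μ {q} ≠ 0 ∧ q ≠ p}, lennardJones (dist p (q : E3)) ≤
        ∑' q : {q : E3 // μ {q} ≠ 0 ∧ q ≠ p}, lennardJones (dist y (q : E3)))
    (hinf : ∀ᵐ μ ∂P, μ univ = ∞) :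
    ∀ᵐ μ ∂P, ∀ y : E3, μ {y} = 0 →
      2 * eStar ≤ (∫⁻ z, ENNReal.ofReal (lennardJones (dist y z)) ∂μ).toReal -
        (∫⁻ z, ENNReal.ofReal (-lennardJones (dist y z)) ∂μ).toReal := by
  have hae : ∀ᵐ μ ∂P, ∀ c : ℚ, (c : ℝ) < 2 * eStar →
      μ ∉ {ν : Measure E3 | ∃ n : ℕ, ν {denseSeq E3 n} = 0 ∧
        (∫⁻ z, ENNReal.ofReal (lennardJones (dist (denseSeq E3 n) z)) ∂ν).toReal -
          (∫⁻ z, ENNReal.ofReal (-lennardJones (dist (denseSeq E3 n) z)) ∂ν).toReal < c} := by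
    rw [ae_all_iff]
    intro c
    by_cases hc : (c : ℝ) < 2 * eStar
    · filter_upwards [compl_mem_ae_iff.2 (measure_holeEvent_eq_zero_of_nash_of_infinite hU hδ ha hb he hinf hc)]
        with μ hμ _ using hμ
    · exact Eventually.of_forall fun μ h => absurd h hc
  filter_upwards [ha, hae] with μ hμ hK y hy
  by_contra hlt
  rw [not_le] at hlt
  obtain ⟨c, hc1, hc2⟩ := exists_rat_btwn hlt
  exact hK c hc2 (mem_holeEvent_of_hole hδ hμ hy hc1)

/-- **THE SHARP VACANCY FLOOR FOR MINIMISING LAWS** («no site better than average»).  Granted the floor of item 9229, a point-stationary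
`δ`-hard-core probability law with a.s. Nash configurations and `E_P[rootEnergy V_LJ] ≤ e⋆` has, almost surely, field `≥ 2e⋆` at every
vacant point — written as the series `Σ'_{q atom} V_LJ(dist y q)`. [folklore] -/
theorem ae_vacancyFloor_sharp_tsum_of_minimising
    (hU : ∀ δ' : ℝ, 0 < δ' → ∀ Q : Measure (Measure E3), IsProbabilityMeasure Q → (∀ᵐ μ ∂Q, IsRootedHardCore δ' μ) →
      IsPointStationaryLaw Q → eStar ≤ ∫ μ, rootEnergy lennardJones μ ∂Q)
    (hδ : 0 < δ) [IsProbabilityMeasure P] (ha : ∀ᵐ μ ∂P, IsRootedHardCore δ μ) (hb : IsPointStationaryLaw P)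
    (he : ∀ᵐ μ ∂P, ∀ p : E3, μ {p} ≠ 0 → ∀ y : E3, (∀ q : E3, μ {q} ≠ 0 → q ≠ p → y ≠ q) →
      ∑' q : {q : E3 // μ {q} ≠ 0 ∧ q ≠ p}, lennardJones (dist p (q : E3)) ≤
        ∑' q : {q : E3 // μ {q} ≠ 0 ∧ q ≠ p}, lennardJones (dist y (q : E3)))
    (hmin : ∫ μ, rootEnergy lennardJones μ ∂P ≤ eStar) :
    ∀ᵐ μ ∂P, ∀ y : E3, μ {y} = 0 →
      2 * eStar ≤ ∑' q : {q : E3 // μ {q} ≠ 0}, lennardJones (dist y (q : E3)) := by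
  have hinf : ∀ᵐ μ ∂P, μ univ = ∞ := by
    filter_upwards [ha, ae_infinite_of_minimising hU hδ ha hb hmin] with μ hμ hμinf
    obtain ⟨S, h0, hsep, rfl⟩ := hμ
    rw [setOf_count_restrict_singleton_ne_zero] at hμinf
    exact count_restrict_univ_of_infinite hμinf
  filter_upwards [ha, ae_vacancyFloor_sharp_of_nash hU hδ ha hb he hinf] with μ hμ hfl y hy
  have h := hfl y hy
  obtain ⟨S, h0, hsep, rfl⟩ := hμ
  have hmem := count_restrict_singleton_ne_zero_iff (E := E3) S
  have hyS : y ∉ S := fun h' => (hmem y).2 h' hy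
  obtain ⟨ρ, hρ, hfar⟩ := exists_pos_forall_le_dist hδ hsep hyS
  rw [← (tsum_lennardJones_dist_eq_parts hδ hsep hρ hfar).2.2] at h
  have h2 : ∑' q : {q : E3 // (Measure.count : Measure E3).restrict S {q} ≠ 0}, lennardJones (dist y (q : E3)) =
      ∑' q : S, lennardJones (dist y (q : E3)) :=
    tsum_congr_set_coe (fun q : E3 => lennardJones (dist y q)) (setOf_count_restrict_singleton_ne_zero S)
  rw [h2]
  exact h

end Law

end Summit.AtomisticToContinuum.Crystallization.Theorems.FrustratedLawDichotomyVacancyFloorSharp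

end
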